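import Summits.Ventures.YMGap.RobustBall.Defs
import Summits.Ventures.YMGap.RobustBall.TorusRange
import Literature.Probability.LatticeModels.PolymerGasGeometric
import Literature.Probability.LatticeModels.LatticeAnimals
import HarnessLib

/-!
# YM3IR / SteinerSize — the hand-over CURRENCY of option (St): the Steiner size `steinerCard` of a site set on the torus

HONEST FRAMING (cell pub-ymgap, track Y4 / YM3-IR, seat ym3ir-theory-2; label K = kernel bookkeeping; tree edition, g44,
2026-08-24, of §§1–2 of the farm-checked HOME scratch `HOME/ym3ir/lean/SteinerCurrency-theory2.scratch.lean` v1.2 sha16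
605f8fc0f6b92b6e, proofs unchanged).  Lead ruling R334 D3 = YES option (St): ONE currency for the A3 hand-over, the
**Steiner size** `steinerCard X` = the least cardinality of a king-connected (`ℓ∞`-adjacency `torusNorm (x - y) ≤ 1`)
superset of the site set `X` on the discrete torus — the lattice version of the tree length `d_j(X)` carried by the printed
ultraviolet output's localisation domains.  It is the size `s X` / `t X` fed to the receiver's affine-diameter doors
(`YM3IR/ReceiverWitness.lean`, `inBall_of_affineDiamData` / `inBall_of_natAffineDiamData`) by the (St) corollary of the
sender's re-indexing half (`YM3IR/Reindex*.lean`, seat ym3ir-theory-1) through `polymerDiam_add_one_le_steinerCard` below;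
neither file is imported here.  This file contains NO conjecture name, NO `sorry`, NO axiom beyond the standard three,
defines nothing under `RobustBall/` (`polymerDiam` is imported READ-ONLY) and claims NO mass gap, NO continuum limit, NO
part of Bałaban's theorems: finite combinatorics of the king graph of the torus, for every `d, L`.

* §1 king adjacency `KingAdj`: touching unions of king-connected sets are king-connected (`isRConnected_union`,
  `isRConnected_insert`); the king ball has `≤ 3^d` sites (`card_kingBall_le`); one king step toward a point lowers the
  `ℓ∞` distance by one (`torusNorm_sub_stepToward_add_one_le`), so any two sites lie on a king-connected set of
  `torusNorm (x - y) + 1` sites (`exists_kingConnected_pair`); on a king-connected set `diam X + 1 ≤ |X|`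
  (`polymerDiam_add_one_le_card`).
* §2 `steinerCard`: attained (`exists_hull`), `|X| ≤ st X` (`card_le_steinerCard`), `= |X|` on king-connected `X`
  (`steinerCard_eq_card`), monotone, ★ `diam X + 1 ≤ st X` (`polymerDiam_add_one_le_steinerCard` — the line the (St)
  corollary uses), `st (X ∪ Y) + 1 ≤ st X + st Y` when `X ∩ Y ≠ ∅`, `≤ st X + st Y` when they touch, and
  `st {x, y} = torusNorm (x - y) + 1`.

NOT HERE: lattice-animal counts in Steiner currency and the Steiner-weight comparisons (scratch §§3–5) — not needed by
the port lemma; they stay in the HOME scratch until a ruling names them.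
-/

namespace Summit.Ventures.YMGap.YM3IR.SteinerSize

open Finset
open Literature.Probability.LatticeModels (IsRConnected Touches exists_step_out reflTransGen_symm_of_symm)
open Literature.MathematicalPhysics.QuantumFieldTheory hiding ZdEdge
open Summit.Ventures.YMGap.RobustBall

/-! ## §1 King adjacency on the torus -/

section Union

variable {V : Type*} {R : V → V → Prop}

/-- A singleton is `R`-connected. [folklore] -/
private theorem isRConnected_singleton (v : V) : IsRConnected R ({v} : Finset V) := by
  refine ⟨⟨v, mem_singleton_self v⟩, fun a ha b hb => ?_⟩
  rw [mem_singleton] at ha hb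
  subst ha; subst hb
  exact Relation.ReflTransGen.refl

/-- Chains inside `S` are chains inside any `T ⊇ S`. [folklore] -/
private theorem chain_mono {S T : Finset V} (hST : S ⊆ T) {a b : V}
    (h : Relation.ReflTransGen (fun x y => R x y ∧ x ∈ S ∧ y ∈ S) a b) :
    Relation.ReflTransGen (fun x y => R x y ∧ x ∈ T ∧ y ∈ T) a b := by
  induction h with
  | refl => exact Relation.ReflTransGen.refl
  | tail _ hbc ih => exact ih.tail ⟨hbc.1, hST hbc.2.1, hST hbc.2.2⟩

/-- **Touching unions of connected sets are connected** (`R` symmetric): if `S` and `T` are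
`R`-connected and share a cell or contain adjacent cells, `S ∪ T` is `R`-connected. [folklore] -/
theorem isRConnected_union [DecidableEq V] (hR : ∀ x y, R x y → R y x) (S T : Finset V)
    (hS : IsRConnected R S) (hT : IsRConnected R T) (h : Touches R S T) :
    IsRConnected R (S ∪ T) := by
  obtain ⟨s, hs, t, ht, hst⟩ := h
  have liftS : ∀ {a b : V}, Relation.ReflTransGen (fun x y => R x y ∧ x ∈ S ∧ y ∈ S) a b →
      Relation.ReflTransGen (fun x y => R x y ∧ x ∈ S ∪ T ∧ y ∈ S ∪ T) a b :=
    fun h => chain_mono subset_union_left h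
  have liftT : ∀ {a b : V}, Relation.ReflTransGen (fun x y => R x y ∧ x ∈ T ∧ y ∈ T) a b →
      Relation.ReflTransGen (fun x y => R x y ∧ x ∈ S ∪ T ∧ y ∈ S ∪ T) a b :=
    fun h => chain_mono subset_union_right h
  have bridge : Relation.ReflTransGen (fun x y => R x y ∧ x ∈ S ∪ T ∧ y ∈ S ∪ T) s t := by
    rcases hst with rfl | hR'
    · exact Relation.ReflTransGen.refl
    · exact Relation.ReflTransGen.single ⟨hR', mem_union_left T hs, mem_union_right S ht⟩
  have bridge' := reflTransGen_symm_of_symm hR bridge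
  refine ⟨⟨s, mem_union_left T hs⟩, fun v hv w hw => ?_⟩
  rcases mem_union.1 hv with hvS | hvT <;> rcases mem_union.1 hw with hwS | hwT
  · exact liftS (hS.2 v hvS w hwS)
  · exact (liftS (hS.2 v hvS s hs)).trans (bridge.trans (liftT (hT.2 t ht w hwT)))
  · exact (liftT (hT.2 v hvT t ht)).trans (bridge'.trans (liftS (hS.2 s hs w hwS)))
  · exact liftT (hT.2 v hvT w hwT)

/-- Adding a cell adjacent to a connected set keeps it connected. [folklore] -/
theorem isRConnected_insert [DecidableEq V] (hR : ∀ x y, R x y → R y x) {S : Finset V}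
    (hS : IsRConnected R S) {y y' : V} (hy' : y' ∈ S) (h : R y y') :
    IsRConnected R (insert y S) := by
  rw [insert_eq]
  exact isRConnected_union hR {y} S (isRConnected_singleton y) hS
    ⟨y, mem_singleton_self y, y', hy', Or.inr h⟩

end Union

variable {d L : ℕ}

/-- King (`ℓ∞`) adjacency on the `d`-torus of side `L`: `torusNorm (x - y) ≤ 1`. [folklore] -/
def KingAdj (x y : Site d L) : Prop := torusNorm (x - y) ≤ 1

/-- `KingAdj` is decidable (it unfolds to `torusNorm (x - y) ≤ 1` on `ℕ`). [folklore] -/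
instance instDecidableRelKingAdj : DecidableRel (KingAdj (d := d) (L := L)) :=
  fun x y => by unfold KingAdj; infer_instance

/-- `torusNorm x ≤ n` coordinatewise. [folklore] -/
theorem torusNorm_le_iff {x : Site d L} {n : ℕ} :
    torusNorm x ≤ n ↔ ∀ i, ((x i).valMinAbs).natAbs ≤ n := by
  unfold torusNorm
  simp [Finset.sup_le_iff]

/-- `torusNorm (x - y) = 0` forces `x = y`. [folklore] -/
theorem eq_of_torusNorm_sub_eq_zero {x y : Site d L} (h : torusNorm (x - y) = 0) : x = y := by
  funext i
  have hi := natAbs_valMinAbs_le_torusNorm (x - y) i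
  rw [h, Nat.le_zero, Int.natAbs_eq_zero, ZMod.valMinAbs_eq_zero, Pi.sub_apply, sub_eq_zero] at hi
  exact hi

/-- King adjacency is symmetric. [folklore] -/
theorem kingAdj_symm : ∀ x y : Site d L, KingAdj x y → KingAdj y x := by
  intro x y h
  unfold KingAdj at h ⊢
  rwa [← torusNorm_neg, neg_sub]

/-- King adjacency is reflexive. [folklore] -/
theorem kingAdj_refl (x : Site d L) : KingAdj x x := by
  unfold KingAdj
  rw [sub_self, torusNorm_zero]
  exact Nat.zero_le _

/-- The unit steps `{-1,0,1}^d`. [folklore] -/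
def unitSteps (d : ℕ) : Finset (Fin d → ℤ) := Fintype.piFinset fun _ => ({-1, 0, 1} : Finset ℤ)

/-- `#{-1,0,1}^d = 3^d`. [folklore] -/
theorem card_unitSteps (d : ℕ) : (unitSteps d).card = 3 ^ d := by
  have h3 : (({-1, 0, 1} : Finset ℤ)).card = 3 := by decide
  rw [unitSteps, Fintype.card_piFinset, prod_const, card_univ, Fintype.card_fin, h3]

/-- The king ball of `x`: the sites `x - t`, `t ∈ {-1,0,1}^d` (a neighbour TABLE for the animal count;
no `Fintype (Site d L)` needed, so every `L` incl. the degenerate `L = 0`). [folklore] -/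
def kingBall (x : Site d L) : Finset (Site d L) :=
  (unitSteps d).image fun t => x - fun i => ((t i : ℤ) : ZMod L)

/-- **King-adjacent sites lie in the king ball**: `y = x - (valMinAbs (x i - y i))_i`. [folklore] -/
theorem mem_kingBall_of_kingAdj {x y : Site d L} (hy : KingAdj x y) : y ∈ kingBall x := by
  have hy1 : torusNorm (x - y) ≤ 1 := hy
  refine mem_image.2 ⟨fun i => ((x - y) i).valMinAbs, ?_, ?_⟩
  · refine Fintype.mem_piFinset.2 fun i => ?_
    have hi : (((x - y) i).valMinAbs).natAbs ≤ 1 :=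
      (natAbs_valMinAbs_le_torusNorm (x - y) i).trans hy1
    simp only [mem_insert, mem_singleton]
    omega
  · funext i
    simp only [Pi.sub_apply, ZMod.coe_valMinAbs, sub_sub_cancel]

/-- **The king ball has at most `3^d` sites.** [folklore] -/
theorem card_kingBall_le (x : Site d L) : (kingBall x).card ≤ 3 ^ d :=
  card_image_le.trans (card_unitSteps d).le

/-- One king step from `y` toward `x`: every coordinate moves by the sign of the centred difference. [folklore] -/
def stepToward (x y : Site d L) : Site d L :=
  y + fun i => ((((x - y) i).valMinAbs.sign : ℤ) : ZMod L)

/-- `|v - sign v| = |v| - 1` (as an inequality valid also at `v = 0`). [folklore] -/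
theorem natAbs_sub_sign_le (v : ℤ) : (v - v.sign).natAbs ≤ v.natAbs - 1 := by
  rcases lt_trichotomy v 0 with h | rfl | h
  · rw [Int.sign_eq_neg_one_of_neg h]; omega
  · decide
  · rw [Int.sign_eq_one_of_pos h]; omega

/-- The step is a king move. [folklore] -/
theorem kingAdj_stepToward (x y : Site d L) : KingAdj y (stepToward x y) := by
  unfold KingAdj
  refine torusNorm_le_iff.2 fun i => ?_
  have hc : (y - stepToward x y) i = (((-((x - y) i).valMinAbs.sign : ℤ)) : ZMod L) := by
    simp only [stepToward, sub_add_cancel_left, Pi.neg_apply, Int.cast_neg]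
  rw [hc]
  refine (natAbs_valMinAbs_intCast_le L _).trans ?_
  rw [Int.natAbs_neg]
  rcases lt_trichotomy ((x - y) i).valMinAbs 0 with h | h | h
  · rw [Int.sign_eq_neg_one_of_neg h]; decide
  · rw [h]; decide
  · rw [Int.sign_eq_one_of_pos h]; decide

/-- **The step lowers the distance by one** (`x ≠ y`). [folklore] -/
theorem torusNorm_sub_stepToward_add_one_le {x y : Site d L} (hxy : x ≠ y) :
    torusNorm (x - stepToward x y) + 1 ≤ torusNorm (x - y) := by
  have hpos : 1 ≤ torusNorm (x - y) := by
    by_contra h0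
    exact hxy (eq_of_torusNorm_sub_eq_zero (by omega))
  suffices h : torusNorm (x - stepToward x y) ≤ torusNorm (x - y) - 1 by omega
  refine torusNorm_le_iff.2 fun i => ?_
  have hvi : (((x - y) i).valMinAbs).natAbs ≤ torusNorm (x - y) := natAbs_valMinAbs_le_torusNorm (x - y) i
  have hc : (x - stepToward x y) i
      = ((((x - y) i).valMinAbs - ((x - y) i).valMinAbs.sign : ℤ) : ZMod L) := by
    have h1 : (x - stepToward x y) i = (x - y) i - ((((x - y) i).valMinAbs.sign : ℤ) : ZMod L) := by
      simp only [stepToward, Pi.sub_apply, Pi.add_apply, sub_add_eq_sub_sub]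
    rw [h1, Int.cast_sub, ZMod.coe_valMinAbs]
  rw [hc]
  refine (natAbs_valMinAbs_intCast_le L _).trans ?_
  exact (natAbs_sub_sign_le _).trans (by omega)

/-- **Any two sites lie on a king-connected set of `torusNorm (x - y) + 1` sites** (a king geodesic). [folklore] -/
theorem exists_kingConnected_pair (x y : Site d L) : ∃ S : Finset (Site d L),
    x ∈ S ∧ y ∈ S ∧ IsRConnected KingAdj S ∧ S.card ≤ torusNorm (x - y) + 1 := by
  classical
  suffices h : ∀ n (y : Site d L), torusNorm (x - y) ≤ n → ∃ S : Finset (Site d L),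
      x ∈ S ∧ y ∈ S ∧ IsRConnected KingAdj S ∧ S.card ≤ torusNorm (x - y) + 1 from h _ y le_rfl
  intro n
  induction n with
  | zero =>
      intro y hy
      have hxy : x = y := eq_of_torusNorm_sub_eq_zero (by omega)
      subst hxy
      exact ⟨{x}, mem_singleton_self x, mem_singleton_self x, isRConnected_singleton x, by simp⟩
  | succ n ih =>
      intro y hy
      by_cases hxy : x = y
      · subst hxy
        exact ⟨{x}, mem_singleton_self x, mem_singleton_self x, isRConnected_singleton x, by simp⟩
      · have hstep := torusNorm_sub_stepToward_add_one_le hxy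
        obtain ⟨S, hxS, hy'S, hS, hcard⟩ := ih (stepToward x y) (by omega)
        refine ⟨insert y S, mem_insert_of_mem hxS, mem_insert_self y S,
          isRConnected_insert kingAdj_symm hS hy'S (kingAdj_stepToward x y), ?_⟩
        exact (card_insert_le y S).trans (by omega)

/-- **Breadth-first growth** (from `ReceiverConn-theory2.scratch.lean`): in a king-connected set every
point is within `ℓ∞`-distance `|X| − 1` of every other. [folklore] -/
theorem torusNorm_sub_le_of_kingConnected {X : Finset (Site d L)} (hX : IsRConnected KingAdj X)
    {v w : Site d L} (hv : v ∈ X) (hw : w ∈ X) : torusNorm (v - w) ≤ X.card - 1 := by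
  classical
  have key : ∀ k, k + 1 ≤ X.card → ∃ T : Finset (Site d L), T ⊆ X ∧ v ∈ T ∧ T.card = k + 1 ∧
      ∀ u ∈ T, torusNorm (v - u) ≤ k := by
    intro k
    induction k with
    | zero =>
        intro _
        refine ⟨{v}, singleton_subset_iff.2 hv, mem_singleton_self v, card_singleton v,
          fun u hu => ?_⟩
        rw [mem_singleton.1 hu, sub_self, torusNorm_zero]
    | succ k ih =>
        intro hk
        obtain ⟨T, hTX, hvT, hTcard, hTdist⟩ := ih (by omega)
        obtain ⟨s, hsX, hsT⟩ : ∃ s ∈ X, s ∉ T := by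
          by_contra hall
          push Not at hall
          have hXT : X ⊆ T := fun s hs => hall s hs
          have := card_le_card hXT
          omega
        obtain ⟨x, y, hxT, hyT, hyX, hxy⟩ := exists_step_out (hX.2 v hv s hsX) hvT hsT
        refine ⟨insert y T, insert_subset hyX hTX, mem_insert_of_mem hvT,
          by rw [card_insert_of_notMem hyT, hTcard], fun u hu => ?_⟩
        rcases mem_insert.1 hu with rfl | hu
        · calc torusNorm (v - u) ≤ torusNorm (v - x) + torusNorm (x - u) := torusNorm_sub_le v x u
            _ ≤ k + 1 := add_le_add (hTdist x hxT) hxy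
        · exact (hTdist u hu).trans (Nat.le_succ k)
  have hpos : 1 ≤ X.card := card_pos.2 ⟨v, hv⟩
  obtain ⟨T, hTX, -, hTcard, hdist⟩ := key (X.card - 1) (by omega)
  have hTX' : T = X := eq_of_subset_of_card_le hTX (by omega)
  subst hTX'
  exact hdist w hw

/-- A king-connected site set has `polymerDiam X + 1 ≤ |X|`. [folklore] -/
theorem polymerDiam_add_one_le_card {X : Finset (Site d L)} (hX : IsRConnected KingAdj X) :
    polymerDiam X + 1 ≤ X.card := by
  have hpos : 1 ≤ X.card := card_pos.2 hX.1
  have h : polymerDiam X ≤ X.card - 1 :=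
    Finset.sup_le fun _ hx => Finset.sup_le fun _ hy => torusNorm_sub_le_of_kingConnected hX hx hy
  omega

/-- The torus diameter is monotone. [folklore] -/
theorem polymerDiam_mono {X Y : Finset (Site d L)} (h : Y ⊆ X) : polymerDiam Y ≤ polymerDiam X :=
  Finset.sup_le fun _ hx => (Finset.sup_mono h).trans
    (Finset.le_sup (f := fun x => X.sup fun y => torusNorm (x - y)) (h hx))

/-! ## §2 Steiner size -/

/-- The cardinalities of the king-connected supersets ("hulls") of `X`. [folklore] -/
def hullCards (X : Finset (Site d L)) : Set ℕ :=
  {n | ∃ S : Finset (Site d L), X ⊆ S ∧ IsRConnected KingAdj S ∧ S.card = n}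

/-- Every site set has a king-connected superset (star of king geodesics). [folklore] -/
theorem hullCards_nonempty (X : Finset (Site d L)) : (hullCards X).Nonempty := by
  classical
  induction X using Finset.induction_on with
  | empty => exact ⟨1, {0}, empty_subset _, isRConnected_singleton 0, card_singleton 0⟩
  | insert a X _ ih =>
      obtain ⟨n, S, hXS, hS, -⟩ := ih
      obtain ⟨x₀, hx₀⟩ := hS.1
      obtain ⟨P, haP, hx₀P, hP, -⟩ := exists_kingConnected_pair a x₀
      refine ⟨(P ∪ S).card, P ∪ S, ?_,
        isRConnected_union kingAdj_symm P S hP hS ⟨x₀, hx₀P, x₀, hx₀, Or.inl rfl⟩, rfl⟩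
      exact insert_subset (mem_union_left S haP) (hXS.trans subset_union_right)

/-- **Steiner size**: the least cardinality of a king-connected superset of `X` (lattice tree length). [folklore] -/
noncomputable def steinerCard (X : Finset (Site d L)) : ℕ := sInf (hullCards X)

/-- A minimal hull exists. [folklore] -/
theorem exists_hull (X : Finset (Site d L)) :
    ∃ S : Finset (Site d L), X ⊆ S ∧ IsRConnected KingAdj S ∧ S.card = steinerCard X :=
  Nat.sInf_mem (hullCards_nonempty X)

/-- Any connected superset bounds the Steiner size. [folklore] -/
theorem steinerCard_le_card {X S : Finset (Site d L)} (hXS : X ⊆ S) (hS : IsRConnected KingAdj S) :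
    steinerCard X ≤ S.card :=
  Nat.sInf_le ⟨S, hXS, hS, rfl⟩

/-- `|X| ≤ st X`. [folklore] -/
theorem card_le_steinerCard (X : Finset (Site d L)) : X.card ≤ steinerCard X := by
  obtain ⟨S, hXS, -, hc⟩ := exists_hull X
  rw [← hc]
  exact card_le_card hXS

/-- `1 ≤ st X` (hulls are nonempty). [folklore] -/
theorem one_le_steinerCard (X : Finset (Site d L)) : 1 ≤ steinerCard X := by
  obtain ⟨S, -, hS, hc⟩ := exists_hull X
  rw [← hc]
  exact card_pos.2 hS.1

/-- **On king-connected sets the Steiner size is the cardinality.** [folklore] -/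
theorem steinerCard_eq_card {X : Finset (Site d L)} (hX : IsRConnected KingAdj X) :
    steinerCard X = X.card :=
  le_antisymm (steinerCard_le_card (Finset.Subset.refl X) hX) (card_le_steinerCard X)

/-- **Monotone.** [folklore] -/
theorem steinerCard_mono {X Y : Finset (Site d L)} (h : Y ⊆ X) : steinerCard Y ≤ steinerCard X := by
  obtain ⟨S, hXS, hS, hc⟩ := exists_hull X
  rw [← hc]
  exact steinerCard_le_card (h.trans hXS) hS

/-- **Dominates the diameter**: `polymerDiam X + 1 ≤ st X`. [folklore] -/
theorem polymerDiam_add_one_le_steinerCard (X : Finset (Site d L)) :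
    polymerDiam X + 1 ≤ steinerCard X := by
  obtain ⟨S, hXS, hS, hc⟩ := exists_hull X
  calc polymerDiam X + 1 ≤ polymerDiam S + 1 := Nat.add_le_add_right (polymerDiam_mono hXS) 1
    _ ≤ S.card := polymerDiam_add_one_le_card hS
    _ = steinerCard X := hc

/-- **Subadditive on overlapping sets**: `st (X ∪ Y) + 1 ≤ st X + st Y` if `X ∩ Y ≠ ∅`. [folklore] -/
theorem steinerCard_union_add_one_le [DecidableEq (Site d L)] {X Y : Finset (Site d L)}
    (h : (X ∩ Y).Nonempty) : steinerCard (X ∪ Y) + 1 ≤ steinerCard X + steinerCard Y := by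
  obtain ⟨S, hXS, hS, hSc⟩ := exists_hull X
  obtain ⟨T, hYT, hT, hTc⟩ := exists_hull Y
  obtain ⟨z, hz⟩ := h
  have hzS : z ∈ S := hXS (mem_inter.1 hz).1
  have hzT : z ∈ T := hYT (mem_inter.1 hz).2
  have hU : IsRConnected KingAdj (S ∪ T) :=
    isRConnected_union kingAdj_symm S T hS hT ⟨z, hzS, z, hzT, Or.inl rfl⟩
  have h1 : steinerCard (X ∪ Y) ≤ (S ∪ T).card := steinerCard_le_card (union_subset_union hXS hYT) hU
  have h2 : (S ∪ T).card + (S ∩ T).card = S.card + T.card := card_union_add_card_inter S T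
  have h3 : 1 ≤ (S ∩ T).card := card_pos.2 ⟨z, mem_inter.2 ⟨hzS, hzT⟩⟩
  omega

/-- **Subadditive on touching sets**: `st (X ∪ Y) ≤ st X + st Y` if `X` and `Y` share a site or
contain king-adjacent sites (the incompatibility relation of the polymer gas). [folklore] -/
theorem steinerCard_union_le_of_touches [DecidableEq (Site d L)] {X Y : Finset (Site d L)}
    (h : Touches KingAdj X Y) : steinerCard (X ∪ Y) ≤ steinerCard X + steinerCard Y := by
  obtain ⟨S, hXS, hS, hSc⟩ := exists_hull X
  obtain ⟨T, hYT, hT, hTc⟩ := exists_hull Y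
  obtain ⟨x, hx, y, hy, hxy⟩ := h
  have hU : IsRConnected KingAdj (S ∪ T) :=
    isRConnected_union kingAdj_symm S T hS hT ⟨x, hXS hx, y, hYT hy, hxy⟩
  calc steinerCard (X ∪ Y) ≤ (S ∪ T).card := steinerCard_le_card (union_subset_union hXS hYT) hU
    _ ≤ S.card + T.card := card_union_le S T
    _ = steinerCard X + steinerCard Y := by rw [hSc, hTc]

/-- **Pairs**: `st {x, y} = torusNorm (x - y) + 1` — both inequalities `diam + 1 ≤ st ≤ …` are sharp. [folklore] -/
theorem steinerCard_pair [DecidableEq (Site d L)] (x y : Site d L) :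
    steinerCard ({x, y} : Finset (Site d L)) = torusNorm (x - y) + 1 := by
  apply le_antisymm
  · obtain ⟨S, hx, hy, hS, hc⟩ := exists_kingConnected_pair x y
    exact (steinerCard_le_card (insert_subset hx (singleton_subset_iff.2 hy)) hS).trans hc
  · have h1 := polymerDiam_add_one_le_steinerCard ({x, y} : Finset (Site d L))
    have h2 : torusNorm (x - y) ≤ polymerDiam ({x, y} : Finset (Site d L)) :=
      torusNorm_sub_le_polymerDiam (mem_insert_self x {y}) (mem_insert_of_mem (mem_singleton_self y))
    omega

end Summit.Ventures.YMGap.YM3IR.SteinerSize
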